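import Literature.Computability.Cryptography.PeikertMachineSpec
import Literature.Computability.QuantumComplexity.HidingProgramMachine
import Literature.Computability.Complexity.CodeFPBudgets
import Literature.Algebra.EuclideanLattices.BabaiListMachine
import Literature.Computability.Complexity.CodeFPOfUnary
import Literature.Computability.Complexity.LengthCompare
import HarnessLib

/-!
# The machine of Peikert's `GapSVP → BDD` reduction: its parameters are polynomial time (typed `FP`)

Topic `Computability/Cryptography` (family `pqc`), first machine file of `PeikertMachineSpec.lean`
(the queries and verdict of the first component of `peikert_gapSVPZeta_to_lwe_classical_of_components`,
pqc.S20). Here: every SCALAR parameter, the sampler's record and the coin layout are computed in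
polynomial time from the code of the input `(instance, q(n), a(n))`, in the typed algebra `CodeFP`
(no machine is written; leaves from `CodeFPArith.lean`, `GapInstanceCodeFP.lean` and the unary
arithmetic of `QuantumComplexity/HidingProgramMachine.lean`). All PROVED:

* `size_eq_log_add_one`, `PGParams.rOf_eq_size`, `two_pow_rOf_le` — the range exponent is a binary
  length, so it is read in unary off a code;
* `dimUn/dimNat/precUn/scaleNat/yNat/meshUn_codeFP` — `n`, `m`, `M`, `Y`, `b`;
* **`stdCtx_codeFP`, `stdCoinLen_codeFP`** — the record `(std m b).ctx` and coin length of the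
  standard sampler as functions of `(1ⁿ, 1ᵇ)` with `m = prec n` (the exponentials `2^m`, `2^k`,
  `Mmax` are polynomial in `n`: explicit budgets);
* `sRows_codeFP`, `numA/denA/kExp/tNum/rNum/rDen_codeFP`, `entryBound_codeFP`, `uBoundUn_codeFP`,
  **`blockLenUn_codeFP`**, `paramsCtx_codeFP`, `paramsCoinLen_codeFP`.

## References

* C. Peikert, *Public-key cryptosystems from the worst-case shortest vector problem*, STOC 2009, proof
  of Thm. 3.1 [Peikert2009].
* S. Arora, B. Barak, *Computational Complexity: A Modern Approach*, CUP 2009, §1.3 [AroraBarak2009].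
-/

noncomputable section

namespace Literature.Computability.Cryptography

namespace Peikert2009

namespace Spec

open Literature.Algebra.EuclideanLattices Literature.Algebra.EuclideanLattices.GapCodes
  Literature.Probability.Distributions Literature.Computability.Complexity
  Literature.Computability.Complexity.CodeFP Literature.Computability.QuantumComplexity Polynomial
  Literature.Computability.Complexity.LMat

/-! ### Binary lengths -/

/-- `size x = ⌊log₂ x⌋ + 1` for `x ≥ 1`. [folklore] -/
theorem size_eq_log_add_one {x : ℕ} (hx : 0 < x) : Nat.size x = Nat.log 2 x + 1 := by
  have h1 : 0 < Nat.size x := Nat.size_pos.2 hx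
  have h2 : 2 ^ (Nat.size x - 1) ≤ x := Nat.lt_size.1 (by omega)
  have h3 : x < 2 ^ (Nat.size x - 1 + 1) := by rw [Nat.sub_add_cancel h1]; exact Nat.lt_size_self x
  have h4 : Nat.log 2 x = Nat.size x - 1 := Nat.log_eq_of_pow_le_of_lt_pow h2 h3
  omega

/-- The range exponent is a binary length: `rOf m = size (m + 1)`. [folklore] -/
theorem _root_.Literature.Probability.Distributions.PGParams.rOf_eq_size (m : ℕ) : PGParams.rOf m = Nat.size (m + 1) := by
  rw [PGParams.rOf, size_eq_log_add_one (Nat.succ_pos m)]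

/-- `2^{rOf m} ≤ 2(m + 1)`. [folklore] -/
theorem two_pow_rOf_le (m : ℕ) : 2 ^ PGParams.rOf m ≤ 2 * (m + 1) := by
  rw [PGParams.rOf_eq_size]; exact two_pow_size_le' (Nat.succ_pos m)

/-- `2^{size n} ≤ 2n + 1`. [folklore] -/
private theorem two_pow_size_le_two_mul_add_one (n : ℕ) : 2 ^ Nat.size n ≤ 2 * n + 1 := by
  rcases Nat.eq_zero_or_pos n with rfl | hn
  · simp
  · exact (two_pow_size_le' hn).trans (Nat.le_succ _)

/-- `rOf` in unary. [folklore] -/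
theorem rOfUn_codeFP : CodeFP unE unE PGParams.rOf := by
  have h := (natSizeU_codeFP.comp (natOfUn.comp unSucc) :)
  exact h.congr fun m => (PGParams.rOf_eq_size m).symm

/-- A capped conversion to unary that is exact. [folklore] -/
private theorem unOfNat_le {α : Type} {eα : α → List Bool} {v cap : α → ℕ} (hv : CodeFP eα natE v) (hc : CodeFP eα unE cap)
    (hle : ∀ a, v a ≤ cap a) : CodeFP eα unE v := by
  have h := (unOfNatMin.comp (hc.pair hv) :)
  exact h.congr fun a => min_eq_left (hle a)

/-! ### The input code and the dimension -/

/-- The code of the typed input `(instance, (q, (num a, den a)))`. [folklore] -/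
abbrev inpE : Inp → List Bool := pairE GapSVPInstance.encode (pairE natE (pairE smE natE))

/-- `n` in unary. [folklore] -/
theorem dimUn_codeFP : CodeFP inpE unE dim := (svpNUn_codeFP.comp (fst _ _) :)

/-- `n` in binary. [folklore] -/
theorem dimNat_codeFP : CodeFP inpE natE dim := (svpN_codeFP.comp (fst _ _) :)

/-- `q(n)`. [folklore] -/
theorem qv_codeFP : CodeFP inpE natE qv := ((snd _ _).fst' :)

/-- `num a(n)`. [folklore] -/
theorem anum_codeFP : CodeFP inpE intE anum := (intOfSM.comp (snd _ _).snd'.fst' :)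

/-- `den a(n)`. [folklore] -/
theorem aden_codeFP : CodeFP inpE natE aden := ((snd _ _).snd'.snd' :)

/-- `num d`. [folklore] -/
theorem dnum_codeFP : CodeFP inpE intE dnum := (svpNum_codeFP.comp (fst _ _) :)

/-- `den d`. [folklore] -/
theorem dden_codeFP : CodeFP inpE natE dden := (svpDen_codeFP.comp (fst _ _) :)

/-! ### `m`, `M`, `Y`, `b` -/

/-- `prec` in unary. [folklore] -/
theorem precOfUn_codeFP : CodeFP unE unE prec := (unAdd.comp ((const _ 80).pair (natSizeU_codeFP.comp natOfUn)) :)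

/-- `m = prec n` in unary. [folklore] -/
theorem precUn_codeFP : CodeFP inpE unE (fun ι => prec (dim ι)) := (precOfUn_codeFP.comp dimUn_codeFP :)

/-- The exponent `m + rOf m + 4` in unary, as a function of `1ⁿ`. [folklore] -/
theorem scaleExpUn_codeFP : CodeFP unE unE (fun n => prec n + PGParams.rOf (prec n) + 4) :=
  (unAdd.comp ((unAdd.comp (precOfUn_codeFP.pair (rOfUn_codeFP.comp precOfUn_codeFP))).pair (const _ 4)) :)

/-- `M = scale n` in binary, as a function of `1ⁿ`. [folklore] -/
theorem scaleOf_codeFP : CodeFP unE natE scale := by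
  have h := (natPow.comp ((const _ 2).pair scaleExpUn_codeFP) :)
  exact h.congr fun n => rfl

/-- `M` in binary. [folklore] -/
theorem scaleNat_codeFP : CodeFP inpE natE (fun ι => scale (dim ι)) := (scaleOf_codeFP.comp dimUn_codeFP :)

/-- `Y` in binary. [folklore] -/
theorem yNat_codeFP : CodeFP inpE natE yOf := by
  have hM2 : CodeFP inpE natE (fun ι => scale (dim ι) ^ 2) := (natPow.comp (scaleNat_codeFP.pair (const _ 2)) :)
  have hnum2 : CodeFP inpE natE (fun ι => (dnum ι).natAbs ^ 2) :=
    (natPow.comp ((intNatAbs.comp dnum_codeFP).pair (const _ 2)) :)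
  have hden2 : CodeFP inpE natE (fun ι => 32 * dden ι ^ 2) :=
    (natMul.comp ((const _ 32).pair (natPow.comp (dden_codeFP.pair (const _ 2)))) :)
  have h := (natDiv.comp ((natMul.comp (hM2.pair hnum2)).pair hden2) :)
  exact h.congr fun _ => rfl

/-- `b = mesh` in unary (`(size Y - 1)/2 ≤ size Y`). [folklore] -/
theorem meshUn_codeFP : CodeFP inpE unE mesh := by
  have hs : CodeFP inpE unE (fun ι => Nat.size (yOf ι)) := (natSizeU_codeFP.comp yNat_codeFP :)
  have hv : CodeFP inpE natE (fun ι => (Nat.size (yOf ι) - 1) / 2) :=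
    (natDiv.comp ((natSub.comp ((natOfUn.comp hs).pair (const _ 1))).pair (const _ 2)) :)
  exact (unOfNat_le hv hs fun ι => by omega).congr fun _ => rfl

/-! ### The standard sampler's record and coin length as functions of `(1ⁿ, 1ᵇ)`, `m = prec n` -/

section StdRecord

/-- The budget of `2^{prec n} ≤ 2^80 (2n + 1)`. [folklore] -/
def precPowBudget : Polynomial ℕ := C (2 ^ 80) * (2 * X + 1)

/-- `2^{prec n} ≤ 2^80 (2n+1)`. [folklore] -/
theorem two_pow_prec_le (n : ℕ) : 2 ^ prec n ≤ precPowBudget.eval n := by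
  rw [precPowBudget, eval_mul, eval_C, eval_add, eval_mul, eval_X, eval_one, eval_ofNat, prec, pow_add]
  exact Nat.mul_le_mul_left _ (two_pow_size_le_two_mul_add_one n)

/-- `prec n + 1 ≤ n + 81`. [folklore] -/
theorem prec_succ_le (n : ℕ) : prec n + 1 ≤ n + 81 := by
  have := Nat.size_le.2 (Nat.lt_two_pow_self (n := n))
  unfold prec; omega

/-- `(2^{rOf (prec n)})² ≤ (2(n + 81))²`. [folklore] -/
theorem two_pow_rOf_prec_sq_le (n : ℕ) : (2 ^ PGParams.rOf (prec n)) ^ 2 ≤ (2 * (n + 81)) ^ 2 :=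
  Nat.pow_le_pow_left ((two_pow_rOf_le _).trans (Nat.mul_le_mul_left 2 (prec_succ_le n))) 2

/-- The budget of `2^{kOf (prec n)} = 8 · 2^{prec n} · (2^{rOf})²`. [folklore] -/
def kPowBudget : Polynomial ℕ := 8 * precPowBudget * (2 * (X + 81)) ^ 2

/-- `2^{kOf (prec n)} ≤ kPowBudget n`. [folklore] -/
theorem two_pow_kOf_le (n : ℕ) : 2 ^ PGParams.kOf (prec n) ≤ kPowBudget.eval n := by
  have hk : 2 ^ PGParams.kOf (prec n) = 2 ^ 3 * 2 ^ prec n * (2 ^ PGParams.rOf (prec n)) ^ 2 := by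
    rw [PGParams.kOf, show prec n + 2 * PGParams.rOf (prec n) + 3 = 3 + prec n + 2 * PGParams.rOf (prec n) by omega,
      pow_add, pow_add, pow_mul']
  have he : kPowBudget.eval n = 8 * precPowBudget.eval n * (2 * (n + 81)) ^ 2 := by
    simp only [kPowBudget, eval_mul, eval_pow, eval_add, eval_X, eval_ofNat]
  rw [hk, he]
  exact Nat.mul_le_mul (Nat.mul_le_mul_left _ (two_pow_prec_le n)) (two_pow_rOf_prec_sq_le n)

/-- The budget of `Mmax = 2^{2 rOf + kOf}`. [folklore] -/
def mmaxBudget : Polynomial ℕ := (2 * (X + 81)) ^ 2 * kPowBudget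

/-- `2^{2 rOf (prec n) + kOf (prec n)} ≤ mmaxBudget n`. [folklore] -/
theorem two_pow_mmax_le (n : ℕ) : 2 ^ (2 * PGParams.rOf (prec n) + PGParams.kOf (prec n)) ≤ mmaxBudget.eval n := by
  have he : mmaxBudget.eval n = (2 * (n + 81)) ^ 2 * kPowBudget.eval n := by
    simp only [mmaxBudget, eval_mul, eval_pow, eval_add, eval_X, eval_ofNat]
  rw [pow_add, pow_mul', he]
  exact Nat.mul_le_mul (two_pow_rOf_prec_sq_le n) (two_pow_kOf_le n)

variable {α : Type} {eα : α → List Bool} {nf bf : α → ℕ}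

/-- The pieces of the record, from `1ⁿ` and `1ᵇ` computed on `eα`-codes. [folklore] -/
theorem stdPieces_codeFP (hn : CodeFP eα unE nf) :
    CodeFP eα unE (fun a => PGParams.rOf (prec (nf a))) ∧
    CodeFP eα unE (fun a => PGParams.kOf (prec (nf a))) ∧
    CodeFP eα unE (fun a => PGParams.JOf (prec (nf a))) ∧
    CodeFP eα unE (fun a => 2 ^ (2 * PGParams.rOf (prec (nf a)) + PGParams.kOf (prec (nf a)))) := by
  have hm : CodeFP eα unE (fun a => prec (nf a)) := (precOfUn_codeFP.comp hn :)
  have hr : CodeFP eα unE (fun a => PGParams.rOf (prec (nf a))) := (rOfUn_codeFP.comp hm :)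
  have hk' : CodeFP eα unE (fun a => prec (nf a) + (PGParams.rOf (prec (nf a)) + PGParams.rOf (prec (nf a))) + 3) :=
    (unAdd.comp ((unAdd.comp (hm.pair (unAdd.comp (hr.pair hr)))).pair (const _ 3)) :)
  have hk : CodeFP eα unE (fun a => PGParams.kOf (prec (nf a))) := hk'.congr fun a => by unfold PGParams.kOf; ring
  -- `2^{rOf}` against the budget `2(m+1)`
  have hpr : CodeFP eα unE (fun a => 2 ^ PGParams.rOf (prec (nf a))) :=
    unPowBudget_codeFP hr ((unMul_codeFP.comp ((const _ 2).pair (unSucc.comp hm))) :) fun a => two_pow_rOf_le _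
  have hJ' : CodeFP eα unE (fun a => 8 * 2 ^ PGParams.rOf (prec (nf a)) * (prec (nf a) + 1)) :=
    (unMul_codeFP.comp ((unMul_codeFP.comp ((const _ 8).pair hpr)).pair (unSucc.comp hm)) :)
  have hJ : CodeFP eα unE (fun a => PGParams.JOf (prec (nf a))) := hJ'.congr fun a => rfl
  -- `Mmax` against its budget
  have ht' : CodeFP eα unE (fun a => PGParams.rOf (prec (nf a)) + PGParams.rOf (prec (nf a)) + PGParams.kOf (prec (nf a))) :=
    (unAdd.comp ((unAdd.comp (hr.pair hr)).pair hk) :)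
  have ht : CodeFP eα unE (fun a => 2 * PGParams.rOf (prec (nf a)) + PGParams.kOf (prec (nf a))) := ht'.congr fun a => by ring
  have hB : CodeFP eα unE (fun a => mmaxBudget.eval (nf a)) := ((unPoly_codeFP mmaxBudget).comp hn :)
  have hmm := unPowBudget_codeFP ht hB fun a => two_pow_mmax_le _
  exact ⟨hr, hk, hJ, hmm⟩

/-- **The record of the standard sampler `std (prec n) b`** from `1ⁿ`, `1ᵇ`. [folklore] -/
theorem stdCtx_codeFP (hn : CodeFP eα unE nf) (hb : CodeFP eα unE bf) :
    CodeFP eα samplerCtxE (fun a => (PGParams.std (prec (nf a)) (bf a)).ctx) := by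
  obtain ⟨hr, hk, hJ, hmm⟩ := stdPieces_codeFP hn
  have hm : CodeFP eα unE (fun a => prec (nf a)) := (precOfUn_codeFP.comp hn :)
  have hhdr : CodeFP eα unE (fun a => PGParams.rOf (prec (nf a)) + bf a + 1) := (unSucc.comp (unAdd.comp (hr.pair hb)) :)
  have hatt : CodeFP eα unE (fun a => PGParams.rOf (prec (nf a)) + bf a + 1 +
      2 ^ (2 * PGParams.rOf (prec (nf a)) + PGParams.kOf (prec (nf a))) * PGParams.kOf (prec (nf a))) :=
    (unAdd.comp (hhdr.pair (unMul_codeFP.comp (hmm.pair hk))) :)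
  have hT : CodeFP eα natE (fun a => 2 ^ (PGParams.rOf (prec (nf a)) + bf a)) :=
    (natPow.comp ((const _ 2).pair (unAdd.comp (hr.pair hb))) :)
  have hpk : CodeFP eα natE (fun a => 2 ^ PGParams.kOf (prec (nf a))) := (natPow.comp ((const _ 2).pair hk) :)
  have hfb : CodeFP eα natE (fun a => 4 ^ bf a) := (natPow.comp ((const _ 4).pair hb) :)
  have h := (hhdr.pair (hk.pair (hmm.pair (hJ.pair (hatt.pair (hT.pair (hpk.pair hfb)))))) :)
  exact h.congr fun a => rfl

/-- **The coin length of the standard sampler `std (prec n) b`** from `1ⁿ`, `1ᵇ`, in unary. [folklore] -/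
theorem stdCoinLen_codeFP (hn : CodeFP eα unE nf) (hb : CodeFP eα unE bf) :
    CodeFP eα unE (fun a => (PGParams.std (prec (nf a)) (bf a)).coinLen) := by
  obtain ⟨hr, hk, hJ, hmm⟩ := stdPieces_codeFP hn
  have hhdr : CodeFP eα unE (fun a => PGParams.rOf (prec (nf a)) + bf a + 1) := (unSucc.comp (unAdd.comp (hr.pair hb)) :)
  have hatt : CodeFP eα unE (fun a => PGParams.rOf (prec (nf a)) + bf a + 1 +
      2 ^ (2 * PGParams.rOf (prec (nf a)) + PGParams.kOf (prec (nf a))) * PGParams.kOf (prec (nf a))) :=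
    (unAdd.comp (hhdr.pair (unMul_codeFP.comp (hmm.pair hk))) :)
  have h := (unMul_codeFP.comp (hJ.pair hatt) :)
  exact h.congr fun a => rfl

end StdRecord

/-- The record of `params`. [folklore] -/
theorem paramsCtx_codeFP : CodeFP inpE samplerCtxE (fun ι => (params ι).ctx) :=
  (stdCtx_codeFP dimUn_codeFP meshUn_codeFP).congr fun _ => rfl

/-- The coin length of `params`, in unary. [folklore] -/
theorem paramsCoinLen_codeFP : CodeFP inpE unE (fun ι => (params ι).coinLen) :=
  (stdCoinLen_codeFP dimUn_codeFP meshUn_codeFP).congr fun _ => rfl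

/-! ### The scaled rows -/

/-- **The scaled basis rows `M · B`** as a list matrix. [cite: Peikert2009, Thm. 3.1 proof] -/
theorem sRows_codeFP : CodeFP inpE matE sRows := by
  have hrows : CodeFP inpE matE (fun ι => matRows ι.1.1.basis) :=
    ((svpRows_codeFP.comp (fst _ _)).congr fun ι => svpRows_eq_matRows ι.1 :)
  have hM : CodeFP inpE intE (fun ι => (scale (dim ι) : ℤ)) := (intOfNat.comp scaleNat_codeFP :)
  -- inner: context `M`, item `z`
  have hitem : CodeFP (pairE intE intE) intE (fun q => q.1 * q.2) := intMul
  have hrow : CodeFP (pairE intE (rawE intE)) (rawE intE) (fun q => q.2.map fun z => q.1 * z) := (map hitem :)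
  have h := ((map (hrow.comp ((fst _ _).pair (snd _ _)))).comp (hM.pair hrows) :)
  exact h.congr fun _ => rfl

/-! ### `A`, `K`, `t`, `r` -/

/-- `numA`. [folklore] -/
theorem numA_codeFP : CodeFP inpE natE numA := by
  have hs : CodeFP inpE natE (fun ι => Nat.sqrt (2 * dim ι) + 1) :=
    (natAdd.comp ((natSqrt.comp (natMul.comp ((const _ 2).pair dimNat_codeFP))).pair (const _ 1)) :)
  have h := (natMul.comp ((natMul.comp ((natMul.comp (qv_codeFP.pair (intNatAbs.comp anum_codeFP))).pair hs)).pair dden_codeFP) :)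
  exact h.congr fun _ => rfl

/-- `denA`. [folklore] -/
theorem denA_codeFP : CodeFP inpE natE denA := by
  have h := (natMul.comp ((natMul.comp ((natMul.comp ((natMul.comp ((const _ 2).pair dimNat_codeFP)).pair scaleNat_codeFP)).pair
    aden_codeFP)).pair (intNatAbs.comp dnum_codeFP)) :)
  exact h.congr fun _ => rfl

/-- `K` in unary. [folklore] -/
theorem kExpUn_codeFP : CodeFP inpE unE kExp := (natSizeU_codeFP.comp (natMul.comp ((const _ 3).pair denA_codeFP)) :)

/-- `t`. [folklore] -/
theorem tNum_codeFP : CodeFP inpE natE tNum := by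
  have hpow : CodeFP inpE natE (fun ι => 2 ^ (kExp ι + 1)) := (natPow.comp ((const _ 2).pair (unSucc.comp kExpUn_codeFP)) :)
  have h := (natDiv.comp ((natSub.comp ((natAdd.comp ((natMul.comp (numA_codeFP.pair hpow)).pair denA_codeFP)).pair (const _ 1))).pair
    (natMul.comp ((const _ 2).pair denA_codeFP))) :)
  exact h.congr fun _ => rfl

/-- `num r = 2t + 1`. [folklore] -/
theorem rNum_codeFP : CodeFP inpE intE rNum := by
  have h := (intAdd.comp ((intMul.comp ((const _ (2 : ℤ)).pair (intOfNat.comp tNum_codeFP))).pair (const _ (1 : ℤ))) :)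
  exact h.congr fun _ => rfl

/-- `den r = 2^{K+1}`. [folklore] -/
theorem rDen_codeFP : CodeFP inpE natE rDen := by
  have h := (natPow.comp ((const _ 2).pair (unSucc.comp kExpUn_codeFP)) :)
  exact h.congr fun _ => rfl

/-! ### The coin layout -/

/-- `∑ |z|` over an integer list, as an integer, is the sum of the `natAbs`. [folklore] -/
theorem sum_map_abs_eq (l : List ℤ) : (l.map fun z => |z|).sum = ((l.map Int.natAbs).sum : ℕ) := by
  induction l with
  | nil => simp
  | cons a l ih => rw [List.map_cons, List.sum_cons, List.map_cons, List.sum_cons, ih, Nat.cast_add, Int.natCast_natAbs]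

/-- The entry bound. [folklore] -/
theorem entryBound_codeFP : CodeFP inpE natE entryBound := by
  have hflat : CodeFP inpE (rawE intE) (fun ι => rowMajor (dim ι) (matRows ι.1.1.basis)) := (svpFlat_codeFP.comp (fst _ _) :)
  have habs : CodeFP inpE intE (fun ι => ((rowMajor (dim ι) (matRows ι.1.1.basis)).map fun z => |z|).sum) :=
    (intSum.comp ((map₀ intAbs).comp hflat) :)
  have hsum' := (intToNat.comp habs :)
  have hsum : CodeFP inpE natE (fun ι => ((rowMajor (dim ι) (matRows ι.1.1.basis)).map Int.natAbs).sum) :=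
    hsum'.congr fun ι => by simp only [sum_map_abs_eq, Int.toNat_natCast]
  have h := (natAdd.comp ((natMul.comp ((natMul.comp (dimNat_codeFP.pair scaleNat_codeFP)).pair hsum)).pair (const _ 1)) :)
  exact h.congr fun _ => rfl

/-- The a-priori query-length bound `uBound`, in unary. [folklore] -/
theorem uBoundUn_codeFP : CodeFP inpE unE uBound := by
  have hrep : CodeFP inpE (rawE intE) (fun ι => List.replicate (dim ι) (entryBound ι : ℤ)) := by
    have hitem : CodeFP (pairE intE natE) intE (fun q => q.1) := fst _ _
    have h := ((map hitem).comp ((intOfNat.comp entryBound_codeFP).pair (urange.comp dimUn_codeFP)) :)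
    exact h.congr fun ι => by simp
  have hcode : CodeFP inpE strE
      (fun ι => cvpCode (dim ι) (sRows ι) (List.replicate (dim ι) (entryBound ι : ℤ)) (rNum ι) (rDen ι)) :=
    (cvpCode_codeFP.comp (((dimUn_codeFP.pair sRows_codeFP).pair hrep).pair (rNum_codeFP.pair rDen_codeFP)) :)
  exact ((strLength.comp hcode).congr fun _ => rfl :)

variable (coinsR : Polynomial ℕ)

/-- The tail length `coinsR (uBound)`, in unary. [folklore] -/
theorem tailLenUn_codeFP : CodeFP inpE unE (fun ι => tailLen ι coinsR) := ((unPoly_codeFP coinsR).comp uBoundUn_codeFP :)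

/-- **The block length `n · coinLen + tailLen`, in unary.** [folklore] -/
theorem blockLenUn_codeFP : CodeFP inpE unE (fun ι => blockLen ι coinsR) := by
  have h := (unAdd.comp ((unMul_codeFP.comp (paramsCoinLen_codeFP.pair dimUn_codeFP)).pair (tailLenUn_codeFP coinsR)) :)
  exact h.congr fun _ => rfl

/-- The sampler part `coinLen · n` of a block, in unary. [folklore] -/
theorem samplerPartUn_codeFP : CodeFP inpE unE (fun ι => (params ι).coinLen * dim ι) :=
  (unMul_codeFP.comp (paramsCoinLen_codeFP.pair dimUn_codeFP) :)

end Spec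

end Peikert2009

end Literature.Computability.Cryptography

end


/-!
# The machine of Peikert's `GapSVP → BDD` reduction: queries in `FP`, verdict in `P`

Topic `Computability/Cryptography` (family `pqc`), second machine file of `PeikertMachineSpec.lean`
(after `PeikertMachineParamsFP.lean`). The query map `query` (block `j` of the coins ↦ perturbation
`w_j` (`samplerVecOf_codeFP`) ↦ Babai residual `x_j` (`Babai.residualL_codeFP`) ↦ `GapCVP` code `u_j`
(`GapCodes.cvpCode_codeFP`) and the solver's coins `c_j`) and the verdict map `verdict` (the closed
form of `decodeIntVec` on the answers, `SISOddPartMachine.canonIV`) are typed polynomial time; read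
through the instance code and the `PolyTimeComputable` parameters `q`, `a` of `IsPolyTimeParams`
(`CodeFP.codeFP_natParam`, `codeFP_ratParam`) they give the STRING functions the truth-table decider
of `Complexity/TruthTableDecidersL.lean` is run with:

* `block_codeFP`, `wL_codeFP`, `xL_codeFP`, `uStr_codeFP`, `cStr_codeFP`, **`query_codeFP`**, `vL_codeFP`;
* `decodedTup_codeFP`, `ansOK_codeFP`, **`verdict_codeFP`**;
* `mkInp_codeFP` and the string level: **`exists_query_mem_FP`** (a `Q ∈ FP` with
  `Q ⟨⟨code p, r⟩, 1ʲ⟩ = query (p, q n, a n) r j`), **`exists_verdict_mem_P`** (a `D ∈ P` whose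
  indicator on `⟨⟨code p, r⟩, code as⟩` is `verdict (p, q n, a n) r as`).

All PROVED; no machine is written.

## References

* C. Peikert, *Public-key cryptosystems from the worst-case shortest vector problem*, STOC 2009, proof
  of Thm. 3.1 [Peikert2009].
* S. Arora, B. Barak, *Computational Complexity: A Modern Approach*, CUP 2009, §1.3, Def. 7.1 [AroraBarak2009].
-/

noncomputable section

namespace Literature.Computability.Cryptography

namespace Peikert2009

namespace Spec

open _root_.Computability Literature.Algebra.EuclideanLattices Literature.Algebra.EuclideanLattices.GapCodes
  Literature.Probability.Distributions Literature.Computability.Complexity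
  Literature.Computability.Complexity.CodeFP Literature.Computability.QuantumComplexity Polynomial
  Literature.Computability.Complexity.LMat Literature.Computability.Cryptography.SIS.OddPartFP

variable (coinsR : Polynomial ℕ)

/-! ### One iteration -/

/-- The code of the query's typed argument `⟨⟨input, coins⟩, 1ʲ⟩`. [folklore] -/
abbrev qArgE : (Inp × List Bool) × ℕ → List Bool := pairE (pairE inpE strE) unE

/-- The typed input, projected. [folklore] -/
theorem qInp_codeFP : CodeFP qArgE inpE (fun t => t.1.1) := (fst _ _).fst'
/-- The coins, projected. [folklore] -/
theorem qCoins_codeFP : CodeFP qArgE strE (fun t => t.1.2) := (fst _ _).snd'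
/-- The iteration index, projected. [folklore] -/
theorem qIdx_codeFP : CodeFP qArgE unE (fun t => t.2) := snd _ _

/-- **Coin block `j`** `= (r.drop (L j)).take L`. [cite: AroraBarak2009, Def. 7.1] -/
theorem block_codeFP : CodeFP qArgE strE (fun t => block t.1.1 coinsR t.1.2 t.2) := by
  have hL : CodeFP qArgE unE (fun t => blockLen t.1.1 coinsR) := ((blockLenUn_codeFP coinsR).comp qInp_codeFP :)
  have hLj : CodeFP qArgE unE (fun t => blockLen t.1.1 coinsR * t.2) := (unMul_codeFP.comp (hL.pair qIdx_codeFP) :)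
  have h := (strTake.comp (hL.pair (strDrop.comp (hLj.pair qCoins_codeFP))) :)
  exact h.congr fun _ => rfl

/-- **The perturbation `w_j`.** [cite: Peikert2009, Thm. 3.1 proof (step 1)] -/
theorem wL_codeFP : CodeFP qArgE (rawE intE) (fun t => wL t.1.1 coinsR t.1.2 t.2) := by
  have h := (samplerVecOf_codeFP.comp ((paramsCtx_codeFP.comp qInp_codeFP).pair ((dimUn_codeFP.comp qInp_codeFP).pair
    ((paramsCoinLen_codeFP.comp qInp_codeFP).pair (block_codeFP coinsR)))) :)
  exact h.congr fun _ => rfl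

/-- **The BDD target `x_j`** (Babai's residual). [cite: Peikert2009, Thm. 3.1 proof (step 2)] -/
theorem xL_codeFP : CodeFP qArgE (rawE intE) (fun t => xL t.1.1 coinsR t.1.2 t.2) := by
  have h := (Babai.residualL_codeFP.comp (((sRows_codeFP.comp qInp_codeFP).pair (wL_codeFP coinsR)).pair (dimUn_codeFP.comp qInp_codeFP)) :)
  exact h.congr fun _ => rfl

/-- **The query code `u_j`.** [cite: Peikert2009, Thm. 3.1 proof (step 3)] -/
theorem uStr_codeFP : CodeFP qArgE strE (fun t => uStr t.1.1 coinsR t.1.2 t.2) := by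
  have h := (cvpCode_codeFP.comp ((((dimUn_codeFP.comp qInp_codeFP).pair (sRows_codeFP.comp qInp_codeFP)).pair (xL_codeFP coinsR)).pair
    ((rNum_codeFP.comp qInp_codeFP).pair (rDen_codeFP.comp qInp_codeFP))) :)
  exact h.congr fun _ => rfl

/-- **The solver's coins `c_j`.** [cite: AroraBarak2009, Def. 7.1] -/
theorem cStr_codeFP : CodeFP qArgE strE (fun t => cStr t.1.1 coinsR t.1.2 t.2) := by
  have hul := (strLength.comp (uStr_codeFP coinsR) :)
  have hlen := ((unPoly_codeFP coinsR).comp hul :)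
  have htail := (strDrop.comp ((samplerPartUn_codeFP.comp qInp_codeFP).pair (block_codeFP coinsR)) :)
  have h := (strTake.comp (hlen.pair htail) :)
  exact h.congr fun _ => rfl

/-- **The query `⟨u_j, c_j⟩` is typed polynomial time.** [cite: Peikert2009, Thm. 3.1 proof] -/
theorem query_codeFP : CodeFP qArgE strE (fun t => query t.1.1 coinsR t.1.2 t.2) :=
  ((uStr_codeFP coinsR).pair (cStr_codeFP coinsR)).recodeOut fun _ => rfl

/-- The expected answer `x_j - w_j`. [cite: Peikert2009, Thm. 3.1 proof (step 4)] -/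
theorem vL_codeFP : CodeFP qArgE (rawE intE) (fun t => vL t.1.1 coinsR t.1.2 t.2) := by
  have hz : CodeFP (pairE unitE (pairE (rawE intE) (rawE intE))) (rawE intE) (fun p => List.zipWith (fun a b => a - b) p.2.1 p.2.2) := by
    exact (zipWith (σ := Unit) (eσ := unitE) (g := fun t => t.2.1 - t.2.2) (intSub.comp ((snd _ _).fst'.pair (snd _ _).snd')) :)
  have h := (hz.comp ((const _ ()).pair ((xL_codeFP coinsR).pair (wL_codeFP coinsR))) :)
  exact h.congr fun _ => rfl

/-! ### The verdict -/

/-- **The closed form of `decodeIntVec` is read off any answer string in polynomial time**: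
`a ↦ (hdrOf a, (lenOf a, entriesOf (lenOf a) a))` is the canonical re-encoding `canonIV`.
[cite: AroraBarak2009, §0.1 (representations)] -/
theorem decodedTup_codeFP : CodeFP strE (pairE natE (pairE unE (rawE smE))) (fun a => (hdrOf a, (lenOf a, entriesOf (lenOf a) a))) :=
  ⟨canonIV, canonIV_mem_FP, fun a => canonIV_apply a⟩

/-- The code of the arguments of `ansOK`: `⟨1ⁿ, ⟨v, a⟩⟩`. [folklore] -/
abbrev okArgE : ℕ × (List ℤ × List Bool) → List Bool := pairE unE (pairE (rawE intE) strE)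

/-- **`ansOK` is typed polynomial time.** [cite: AroraBarak2009, §1.3] -/
theorem ansOK_codeFP : CodeFP okArgE bitE (fun t => ansOK t.1 t.2.1 t.2.2) := by
  have hn : CodeFP okArgE unE (fun t => t.1) := fst _ _
  have hv : CodeFP okArgE (rawE intE) (fun t => t.2.1) := (snd _ _).fst'
  have hdec : CodeFP okArgE (pairE natE (pairE unE (rawE smE))) (fun t => (hdrOf t.2.2, (lenOf t.2.2, entriesOf (lenOf t.2.2) t.2.2))) :=
    (decodedTup_codeFP.comp (snd _ _).snd' :)
  have hes' := ((map₀ intOfSM).comp hdec.snd'.snd' :)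
  have hes : CodeFP okArgE (rawE intE) (fun t => entriesOf (lenOf t.2.2) t.2.2) := hes'.congr fun t => by simp
  -- the header tests
  have hh : CodeFP okArgE bitE (fun t => decide (hdrOf t.2.2 = t.1)) := (natEq.comp (hdec.fst'.pair (natOfUn.comp hn)) :)
  have hl : CodeFP okArgE bitE (fun t => decide (lenOf t.2.2 = t.1)) := (natEq.comp ((natOfUn.comp hdec.snd'.fst').pair (natOfUn.comp hn)) :)
  -- the coordinate tests
  have hitem1 : CodeFP (pairE (pairE (rawE intE) (rawE intE)) natE) bitE (fun q => decide (q.1.1.getD q.2 0 = q.1.2.getD q.2 0)) :=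
    (intEq.comp (((rawGetOr intE).comp ((fst _ _).fst'.pair ((snd _ _).pair (const _ (0 : ℤ))))).pair
      ((rawGetOr intE).comp ((fst _ _).snd'.pair ((snd _ _).pair (const _ (0 : ℤ)))))) :)
  have hall1' := ((all hitem1).comp ((hes.pair hv).pair (urange.comp hn)) :)
  have hall1 : CodeFP okArgE bitE (fun t => (List.range t.1).all fun i => decide ((entriesOf (lenOf t.2.2) t.2.2).getD i 0 = t.2.1.getD i 0)) :=
    hall1'.congr fun _ => rfl
  have hitem2 : CodeFP (pairE (rawE intE) natE) bitE (fun q => decide (q.1.getD q.2 0 = 0)) :=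
    (intEq.comp (((rawGetOr intE).comp ((fst _ _).pair ((snd _ _).pair (const _ (0 : ℤ))))).pair (const _ (0 : ℤ))) :)
  have hall2' := ((all hitem2).comp (hv.pair (urange.comp hn)) :)
  have hall2 : CodeFP okArgE bitE (fun t => (List.range t.1).all fun i => decide (t.2.1.getD i 0 = 0)) := hall2'.congr fun _ => rfl
  have h := (ite (hh.and hl) hall1 hall2 :)
  refine h.congr fun t => ?_
  obtain ⟨n, v, a⟩ := t
  simp only [ansOK]
  by_cases hc : hdrOf a = n ∧ lenOf a = n
  · rw [if_pos hc, if_pos (by simp [hc]), hc.2]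
  · rw [if_neg hc, if_neg (by simpa [Bool.and_eq_true, decide_eq_true_eq] using hc)]

/-- The code of the verdict's typed argument `⟨⟨input, coins⟩, [a₀, …]⟩` (answers as a headed list of
strings, the transcript format of `ttAlgL`). [folklore] -/
abbrev dArgE : (Inp × List Bool) × List (List Bool) → List Bool := pairE (pairE inpE strE) (listE strE)

/-- **The verdict is typed polynomial time.** [cite: Peikert2009, Thm. 3.1 proof (step 4)] -/
theorem verdict_codeFP : CodeFP dArgE bitE (fun t => verdict t.1.1 coinsR t.1.2 t.2) := by
  have hι : CodeFP dArgE inpE (fun t => t.1.1) := (fst _ _).fst'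
  have hr : CodeFP dArgE strE (fun t => t.1.2) := (fst _ _).snd'
  have has : CodeFP dArgE (rawE strE) (fun t => t.2) := ((rawOfList strE).comp (snd _ _) :)
  have hd : CodeFP dArgE bitE (fun t => decide ((dden t.1.1 : ℤ) ≤ dnum t.1.1)) :=
    (intLe.comp ((intOfNat.comp (dden_codeFP.comp hι)).pair (dnum_codeFP.comp hι)) :)
  -- item `j` (binary, clipped to `1^{min j N₀}`) with context `((ι, r), as)`
  have hN0 : CodeFP (pairE (pairE (pairE inpE strE) (rawE strE)) natE) unE (fun _ => iters) := const _ iters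
  have hj : CodeFP (pairE (pairE (pairE inpE strE) (rawE strE)) natE) unE (fun q => min q.2 iters) :=
    (unOfNatMin.comp (hN0.pair (snd _ _)) :)
  have hitem : CodeFP (pairE (pairE (pairE inpE strE) (rawE strE)) natE) bitE
      (fun q => !ansOK (dim q.1.1.1) (vL q.1.1.1 coinsR q.1.1.2 (min q.2 iters)) (q.1.2.getD q.2 [])) := by
    have qv : CodeFP (pairE (pairE (pairE inpE strE) (rawE strE)) natE) (rawE intE) (fun q => vL q.1.1.1 coinsR q.1.1.2 (min q.2 iters)) :=
      ((vL_codeFP coinsR).comp (((fst _ _).fst').pair hj) :)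
    have qa : CodeFP (pairE (pairE (pairE inpE strE) (rawE strE)) natE) strE (fun q => q.1.2.getD q.2 []) :=
      ((rawGetD strE (d := ([] : List Bool)) rfl).comp ((fst _ _).snd'.pair (snd _ _)) :)
    have qn : CodeFP (pairE (pairE (pairE inpE strE) (rawE strE)) natE) unE (fun q => dim q.1.1.1) := (dimUn_codeFP.comp (fst _ _).fst'.fst' :)
    exact ((ansOK_codeFP.comp (qn.pair (qv.pair qa))).not :)
  have hrange : CodeFP dArgE (rawE natE) (fun _ => List.range iters) := (urange.comp (const _ iters : CodeFP dArgE unE fun _ => iters) :)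
  have hctx : CodeFP dArgE (pairE (pairE inpE strE) (rawE strE)) (fun t => (t.1, t.2)) := ((fst _ _).pair has :)
  have hany' := ((any hitem).comp (hctx.pair hrange) :)
  have hany : CodeFP dArgE bitE (fun t => (List.range iters).any fun j => !ansOK (dim t.1.1) (vL t.1.1 coinsR t.1.2 j) (t.2.getD j [])) := by
    refine hany'.congr fun t => ?_
    show ((List.range iters).any fun j => !ansOK (dim t.1.1) (vL t.1.1 coinsR t.1.2 (min j iters)) (t.2.getD j [])) = _
    rw [Bool.eq_iff_iff, List.any_eq_true, List.any_eq_true]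
    constructor
    · rintro ⟨j, hj, h⟩
      exact ⟨j, hj, by rwa [min_eq_left (le_of_lt (List.mem_range.1 hj))] at h⟩
    · rintro ⟨j, hj, h⟩
      exact ⟨j, hj, by rwa [min_eq_left (le_of_lt (List.mem_range.1 hj))]⟩
  have h := (hd.and hany :)
  exact h.congr fun _ => rfl

/-! ### The string level -/

variable {q : ℕ → ℕ} {a : ℕ → ℚ}

/-- The typed input `(p, (q n, (num a n, den a n)))` of the instance `p`. [folklore] -/
def mkInp (q : ℕ → ℕ) (a : ℕ → ℚ) (p : GapSVPInstance) : Inp := (p, (q p.1.n, ((a p.1.n).num, (a p.1.n).den)))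

/-- **The typed input is computed from the instance code**, given the `PolyTimeComputable`
parameters. [cite: AroraBarak2009, §1.3] -/
theorem mkInp_codeFP (hq : PolyTimeComputable unaryEncodeNat encodeNat q) (ha : PolyTimeComputable unaryEncodeNat encodeRat a) :
    CodeFP GapSVPInstance.encode inpE (mkInp q a) := by
  have hq' := codeFP_natParam hq
  have ha' := codeFP_ratParam ha
  have h := ((CodeFP.id GapSVPInstance.encode).pair ((hq'.comp svpNUn_codeFP).pair (ha'.comp svpNUn_codeFP)) :)
  exact h.congr fun _ => rfl

/-- **The query string function is in `FP`.** [cite: Peikert2009, Thm. 3.1 proof; AroraBarak2009, §1.3] -/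
theorem exists_query_mem_FP (hq : PolyTimeComputable unaryEncodeNat encodeNat q)
    (ha : PolyTimeComputable unaryEncodeNat encodeRat a) :
    ∃ Q : List Bool → List Bool, Q ∈ FP ∧ ∀ (p : GapSVPInstance) (r : List Bool) (j : ℕ),
      Q (boolPair (boolPair p.encode r) (List.replicate j true)) = query (mkInp q a p) coinsR r j := by
  have hin : CodeFP (pairE (pairE GapSVPInstance.encode strE) unE) qArgE (fun t => ((mkInp q a t.1.1, t.1.2), t.2)) :=
    ((((mkInp_codeFP hq ha).comp (fst _ _).fst').pair (fst _ _).snd').pair (snd _ _) :)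
  obtain ⟨Q, hQ, hQe⟩ := (query_codeFP coinsR).comp hin
  refine ⟨Q, hQ, fun p r j => ?_⟩
  have := hQe ((p, r), j)
  simpa [unE_eq_ones, ones] using this

/-- **The verdict language is in `P`.** [cite: Peikert2009, Thm. 3.1 proof; AroraBarak2009, §1.3] -/
theorem exists_verdict_mem_P (hq : PolyTimeComputable unaryEncodeNat encodeNat q)
    (ha : PolyTimeComputable unaryEncodeNat encodeRat a) :
    ∃ D : Language Bool, D ∈ Classes.P ∧ ∀ (p : GapSVPInstance) (r : List Bool) (as : List (List Bool)),
      D.boolIndicator (boolPair (boolPair p.encode r) ((encodingList Bool).listBool.encode as)) = verdict (mkInp q a p) coinsR r as := by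
  have hin : CodeFP (pairE (pairE GapSVPInstance.encode strE) (listE strE)) dArgE (fun t => ((mkInp q a t.1.1, t.1.2), t.2)) :=
    ((((mkInp_codeFP hq ha).comp (fst _ _).fst').pair (fst _ _).snd').pair (snd _ _) :)
  obtain ⟨G, hG, hGe⟩ := (verdict_codeFP coinsR).comp hin
  -- normalise `G` to a `{[true], [false]}`-valued function (agreeing on `[true]`)
  obtain ⟨N, hN, hNe⟩ := ((CodeFP.eq (eα := strE) fun _ _ h => h).comp ((CodeFP.id strE).pair (const strE ([true] : List Bool))) :
    CodeFP strE bitE fun w => decide (w = [true]))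
  have hNw : ∀ w, N w = [decide (w = [true])] := fun w => hNe w
  refine ⟨{w | G w = [true]}, mem_P_of_mem_FP (comp_mem_FP hN hG) _ fun w => ⟨fun h => ?_, fun h => ?_⟩, fun p r as => ?_⟩
  · have hw : G w = [true] := h
    rw [Function.comp_apply, hNw, hw]; rfl
  · have hw : G w ≠ [true] := h
    rw [Function.comp_apply, hNw, decide_eq_false hw]
  · have hcode : boolPair (boolPair p.encode r) ((encodingList Bool).listBool.encode as) =
        pairE (pairE GapSVPInstance.encode strE) (listE strE) ((p, r), as) := by
      rw [listE_eq]; rfl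
    have hGv : G (boolPair (boolPair p.encode r) ((encodingList Bool).listBool.encode as)) = [verdict (mkInp q a p) coinsR r as] := by
      rw [hcode]; exact hGe ((p, r), as)
    unfold Set.boolIndicator
    simp only [Set.mem_setOf_eq, hGv, List.cons.injEq, and_true]
    cases verdict (mkInp q a p) coinsR r as <;> simp

end Spec

end Peikert2009

end Literature.Computability.Cryptography

end
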